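import Mathlib
import HarnessLib
import Literature.Computability.AlgebraicComplexity.GrenetEquivariant
import Summits.ValiantsHypothesis.ValiantsHypothesis.Theorems.EquivariantDialLayersLifts

/-!
# Equivariant-dc dial: the GRADED BRIDGE — every equivariant layered program is equivariant under the
# dilations, so `A^gr ⟹ A^lay` and Theorem H («grading costs a polynomial») reduces to LAYERING
# (decomp-valiant workshop, lens 1, generation 16) — support file of census cell A; NOT a route

HONEST FRAMING.  `VP ≠ VNP` (the tree's `ValiantsHypothesis`) is NOT proved here and nothing in this file is
progress on it.  This is a sorry-free SUPPORT file of the census cell `A = EquivariantDialNode.EqHardBiPerm`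
(item `stmt-ValiantsHypothesis-23702`, supported, not closed).  It is the LAST ARROW of the homogenisation
theorem «Theorem H» of the workshop record (NODE-g13 §2, Lean signature `EquivariantDialGrading.GradingCost`):

  equivariant det. repr. ─(1: block gauge)→ block-gauge repr. ─(2: Schur complement + Newton)→ equivariant
  LAYERED program ─(3: THIS FILE)→ GRADED equivariant det. repr. (equivariant also under `x ↦ t • x`).

## What is proved (kernel-checked, no `sorry`, no new axioms)

* §1 `linSubst_diagonal_const_of_isHomogeneous`: the dilation `x ↦ t x` multiplies a form of degree `n` by
  `t ^ n` (the grading of `MvPolynomial` by degree, [Landsberg2017, §1.2]).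
* §2 `LayeredABP.liftScalar`: EVERY homogeneous layered program ([Nisan1991Noncommutative, §2]; the tree's
  `LayeredABP`) carries an exact layerwise lift of each dilation — `R d = t^{-d} · 1`, source eigenvalue `1`,
  sink eigenvalue `t^{-L}` (`nonempty_lift_of_scalar` for the generators of the tree's `scalarSubst`;
  `liftOne`).
* §3 LIFTS GENERATE (`isEquivariantDetRepr_vmat_closure`, from the tree's
  `IsEquivariantDetRepr.of_generators` [LandsbergRessayre2017, Def 1.3] and the g14 lift identity `vmat_lift`):
  Valiant's matrix of a program with exact layerwise lifts on a SET `S` of substitutions is an exactly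
  equivariant determinantal representation for the subgroup GENERATED by `S`; hence the **graded bridge**
  `hasEquivariantDetRepr_graded_of_isEquivariant` : a `Γ`-equivariant layered program of width `w`, length `L`
  gives a `Γ ⊔ (dilations)`-equivariant affine determinantal representation of size `w (L + 3)`.
* §4 Over `ℂ` at every notch `H`: `polyEquivariant_graded_of_polyLayered` (`PolyLayered H ⟹ PolyEquivariant
  (graded H)`), the census arrow **`A^gr ⟹ A^lay`** (`eqHardLayered_of_eqHardGraded`,
  `eqHardLayeredBiPerm_of_eqHardBiPermGraded`), so the cell's chain is now
  `S ⟹ W ⟹ A ⟹ A^gr ⟹ A^lay ⟸ R^lay` (all kernel); and the REDUCTION OF THEOREM H TO LAYERING: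
  `LayeringCost H` («every `H_m`-equivariant representation of `per_m` of size `s` yields an `H_m`-equivariant
  layered program of width `≤ a (m+s+1)^b`» = arrows 1+2) gives `GradingCost H` (`gradingCost_of_layeringCost`),
  and `LayeringFree H ⟹ GradingFree H`; under `LayeringFree H` the three notches coincide
  (`eqHard_iff_layered`, `eqHardGraded_iff_layered`).

Census reading (workshop grammar): no new cell; `A`, `A^gr`, `A^lay` keep their tags (WEAKER·NEC·OPEN); the
arrow `A^gr ⟹ A^lay` is now KERNEL (was open in `EquivariantDialLayers` §«Census tags»); Theorem H's Lean-open
part is exactly `LayeringCost biPermSubst` (typed here), whose arrow 2 is elementary linear algebra (Schur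
complement, Newton/Le Verrier) and whose arrow 1 is the Wedderburn–Maschke block gauge of NODE-g13 §2 (1)–(2).
No `instance`, no `notation`; nothing from `Literature` is restated.
-/

set_option linter.dupNamespace false

namespace Summit.ValiantsHypothesis.ValiantsHypothesis.Theorems.EquivariantDialLayers

open MvPolynomial Matrix Literature.Computability.AlgebraicComplexity
open Summit.ValiantsHypothesis.ValiantsHypothesis.Theorems.EquivariantDialNode
open Summit.ValiantsHypothesis.ValiantsHypothesis.Theorems.EquivariantDialGrading

noncomputable section

/-! ## §1 Dilations act on forms by powers -/

section Scalar

variable {σ : Type*} {k : Type*} [CommRing k] [Fintype σ] [DecidableEq σ]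

/-- The dilation `x ↦ t • x` multiplies a form of degree `n` by `t ^ n`. -/
theorem linSubst_diagonal_const_of_isHomogeneous (t : k) {p : MvPolynomial σ k} {n : ℕ}
    (hp : p.IsHomogeneous n) : linSubst σ k (Matrix.diagonal fun _ => t) p = t ^ n • p := by
  have hX : (fun i : σ => ∑ j, (Matrix.diagonal (fun _ => t) : Matrix σ σ k) j i • (X j : MvPolynomial σ k)) =
      fun i => C t * X i := by
    funext i
    rw [Finset.sum_eq_single i (fun j _ hji => by rw [Matrix.diagonal_apply_ne _ hji, zero_smul])
      (fun h => absurd (Finset.mem_univ i) h), Matrix.diagonal_apply_eq, smul_eq_C_mul]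
  simp only [linSubst, hX]
  conv_lhs => rw [← p.support_sum_monomial_coeff]
  conv_rhs => rw [← p.support_sum_monomial_coeff]
  rw [map_sum, Finset.smul_sum]
  refine Finset.sum_congr rfl fun s hs => ?_
  rw [aeval_monomial, smul_monomial, monomial_eq, ← hp (mem_support_iff.mp hs)]
  simp only [Finsupp.prod, mul_pow, Finset.prod_mul_distrib, Finset.prod_pow_eq_pow_sum, algebraMap_eq,
    map_mul, map_pow, Finsupp.weight_apply, Pi.one_apply, smul_eq_mul, mul_one, Finsupp.sum]
  ring

/-- In particular a dilation multiplies a linear form by `t`. -/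
theorem linSubst_diagonal_const_of_isHomogeneous_one (t : k) {p : MvPolynomial σ k} (hp : p.IsHomogeneous 1) :
    linSubst σ k (Matrix.diagonal fun _ => t) p = C t * p := by
  rw [linSubst_diagonal_const_of_isHomogeneous t hp, pow_one, smul_eq_C_mul]

end Scalar

/-! ## §2 Every layered program lifts the dilations -/

section ScalarLift

variable {σ : Type*} {k : Type*} [CommRing k] {L w : ℕ}

namespace LayeredABP

/-- A constant diagonal unit `u · 1 ∈ GL_w(k)`. -/
def scalarGL (w : ℕ) (u : kˣ) : GL (Fin w) k :=
  ⟨Matrix.diagonal fun _ => (u : k), Matrix.diagonal fun _ => ((u⁻¹ : kˣ) : k),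
    by rw [Matrix.diagonal_mul_diagonal, ← Matrix.diagonal_one]
       exact congrArg Matrix.diagonal (funext fun _ => u.mul_inv),
    by rw [Matrix.diagonal_mul_diagonal, ← Matrix.diagonal_one]
       exact congrArg Matrix.diagonal (funext fun _ => u.inv_mul)⟩

/-- The matrix of `scalarGL`. -/
@[simp] theorem coe_scalarGL (u : kˣ) :
    ((scalarGL w u : GL (Fin w) k) : Matrix (Fin w) (Fin w) k) = Matrix.diagonal fun _ => (u : k) := rfl

/-- The matrix of the inverse of `scalarGL`. -/
@[simp] theorem coe_scalarGL_inv (u : kˣ) :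
    (((scalarGL w u)⁻¹ : GL (Fin w) k) : Matrix (Fin w) (Fin w) k) = Matrix.diagonal fun _ => ((u⁻¹ : kˣ) : k) :=
  rfl

variable [Fintype σ] [DecidableEq σ] (P : LayeredABP σ k L w)

/-- The identity substitution lifts (trivially). -/
def liftOne : P.Lift 1 where
  R _ := 1
  a := 1
  b := 1
  layer t := by
    rw [Matrix.linSubstEntries_one, Units.val_one, inv_one, Units.val_one, Matrix.map_one C C_0 C_1,
      Matrix.one_mul, Matrix.mul_one]
  src := by rw [Units.val_one, Matrix.vecMul_one, Units.val_one, one_smul]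
  snk := by rw [Units.val_one, Matrix.one_mulVec, Units.val_one, one_smul]

/-- **Every homogeneous layered program lifts each dilation `x ↦ u • x` exactly**: the lift on vertex
layer `d` is `u^{-d} · 1` (a variable edge raises the degree by exactly one), the source vector has
eigenvalue `1` and the sink vector eigenvalue `u^{-L}`. -/
def liftScalar (u : kˣ) (γ : GL σ k) (hγ : (γ : Matrix σ σ k) = Matrix.diagonal fun _ => (u : k)) :
    P.Lift γ where
  R d := scalarGL w (u⁻¹ ^ (d : ℕ))
  a := u⁻¹ ^ (0 : ℕ)
  b := u⁻¹ ^ L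
  layer t := by
    refine Matrix.ext fun i j => ?_
    rw [Matrix.linSubstEntries_apply, hγ, linSubst_diagonal_const_of_isHomogeneous_one _ (P.linear t i j),
      coe_scalarGL, coe_scalarGL_inv, Matrix.diagonal_map (map_zero C), Matrix.diagonal_map (map_zero C),
      Matrix.mul_diagonal, Matrix.diagonal_mul, Fin.val_castSucc, Fin.val_succ]
    have hu : (((u⁻¹ ^ (t : ℕ) : kˣ) : k)) * (((u⁻¹ ^ ((t : ℕ) + 1))⁻¹ : kˣ) : k) = (u : k) := by
      rw [← Units.val_mul, pow_succ, mul_inv, inv_inv, ← mul_assoc, mul_inv_cancel, one_mul]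
    rw [mul_comm (C _ * P.T t i j) (C _), ← mul_assoc, ← map_mul, mul_comm (((u⁻¹ ^ ((t : ℕ) + 1))⁻¹ : kˣ) : k),
      hu]
  src := by
    funext j
    rw [coe_scalarGL, Matrix.vecMul_diagonal, Pi.smul_apply, smul_eq_mul, mul_comm, Fin.val_zero]
  snk := by
    funext i
    rw [coe_scalarGL, Matrix.mulVec_diagonal, Pi.smul_apply, smul_eq_mul, Fin.val_last]

/-- Hence every generator of the dilation group (`γ = t · 1`) admits an exact layerwise lift: if there are
variables, `t` is a unit (read off `γ γ⁻¹ = 1`); if there are none, `γ = 1`. -/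
theorem nonempty_lift_of_scalar (γ : GL σ k) (hγ : ∃ t : k, (γ : Matrix σ σ k) = Matrix.diagonal fun _ => t) :
    Nonempty (P.Lift γ) := by
  obtain ⟨t, ht⟩ := hγ
  rcases isEmpty_or_nonempty σ with hσ | ⟨⟨i⟩⟩
  · obtain rfl : γ = 1 := Subsingleton.elim _ _
    exact ⟨P.liftOne⟩
  · have h1 : t * ((γ⁻¹ : GL σ k) : Matrix σ σ k) i i = 1 := by
      have h := congrFun (congrFun (γ.mul_inv : (γ : Matrix σ σ k) * ((γ⁻¹ : GL σ k) : Matrix σ σ k) = 1) i) i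
      rwa [ht, Matrix.diagonal_mul, Matrix.one_apply_eq] at h
    have h2 : ((γ⁻¹ : GL σ k) : Matrix σ σ k) i i * t = 1 := by
      have h := congrFun (congrFun (γ.inv_mul : ((γ⁻¹ : GL σ k) : Matrix σ σ k) * (γ : Matrix σ σ k) = 1) i) i
      rwa [ht, Matrix.mul_diagonal, Matrix.one_apply_eq] at h
    exact ⟨P.liftScalar ⟨t, _, h1, h2⟩ γ ht⟩

end LayeredABP

end ScalarLift

/-! ## §3 Lifts generate: equivariance of Valiant's matrix for generated subgroups; the graded bridge -/

section Generate

variable {σ : Type*} {k : Type*} [CommRing k] {L w : ℕ} [Fintype σ] [DecidableEq σ]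

namespace LayeredABP

variable {P : LayeredABP σ k L w} [NeZero w]

/-- **Lifts generate.**  If every substitution in a set `S` has an exact layerwise lift to the program `P`,
then Valiant's matrix of `P` (any reindexing) is an exactly `⟨S⟩`-equivariant affine determinantal
representation of the computed polynomial: the block-diagonal lifts `gGL Λ`, `hGL Λ` of the generators
compose and invert inside `GL × GL` (`IsEquivariantDetRepr.of_generators`). -/
theorem isEquivariantDetRepr_vmat_closure {S : Set (GL σ k)} (hS : ∀ γ ∈ S, Nonempty (P.Lift γ)) {N : ℕ}
    (e : Vtx L w ≃ Fin N) : IsEquivariantDetRepr (Subgroup.closure S) P.eval (P.vmat.submatrix e.symm e.symm) := by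
  refine IsEquivariantDetRepr.of_generators (P.isAffineDetRepr_vmat e) fun γ hγ => ?_
  obtain ⟨Λ⟩ := hS γ hγ
  refine ⟨glReindex e (gGL Λ), glReindex e (hGL Λ), ?_⟩
  have hg : ((glReindex e (gGL Λ) : GL (Fin N) k) : Matrix _ _ k) =
      (Matrix.blockDiagonal (gBlk Λ)).submatrix e.symm e.symm := rfl
  have hh : (((glReindex e (hGL Λ))⁻¹ : GL (Fin N) k) : Matrix _ _ k) =
      (Matrix.blockDiagonal (hInvBlk Λ)).submatrix e.symm e.symm := rfl
  have h1 : Matrix.blockDiagonal (hBlk Λ) * Matrix.blockDiagonal (hInvBlk Λ) = 1 := (hGL Λ).val_inv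
  have h2 : (Matrix.blockDiagonal (hBlk Λ)).map (C : k →+* MvPolynomial σ k) *
      (Matrix.blockDiagonal (hInvBlk Λ)).map (C : k →+* MvPolynomial σ k) = 1 := by
    rw [← Matrix.map_mul, h1, Matrix.map_one _ C_0 C_1]
  have hV : Matrix.linSubstEntries γ P.vmat =
      (Matrix.blockDiagonal (gBlk Λ)).map (C : k →+* MvPolynomial σ k) * P.vmat *
        (Matrix.blockDiagonal (hInvBlk Λ)).map (C : k →+* MvPolynomial σ k) := by
    calc Matrix.linSubstEntries γ P.vmat
        = Matrix.linSubstEntries γ P.vmat * ((Matrix.blockDiagonal (hBlk Λ)).map (C : k →+* MvPolynomial σ k) *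
            (Matrix.blockDiagonal (hInvBlk Λ)).map (C : k →+* MvPolynomial σ k)) := by rw [h2, Matrix.mul_one]
      _ = _ := by rw [← Matrix.mul_assoc, ← vmat_lift]
  rw [hg, hh, linSubstEntries_submatrix_aux, hV, ← Matrix.submatrix_mul_equiv _ _ e.symm e.symm e.symm,
    ← Matrix.submatrix_mul_equiv _ _ e.symm e.symm e.symm, Matrix.submatrix_map, Matrix.submatrix_map]

/-- Existential form: lifts on a generating set give `HasEquivariantDetRepr ⟨S⟩` of size `w (L + 3)`. -/
theorem hasEquivariantDetRepr_closure_of_lifts {S : Set (GL σ k)} (hS : ∀ γ ∈ S, Nonempty (P.Lift γ)) :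
    HasEquivariantDetRepr (Subgroup.closure S) P.eval (w * (L + 3)) := by
  have hcard : Fintype.card (Vtx L w) = w * (L + 3) := by simp
  exact ⟨_, P.isEquivariantDetRepr_vmat_closure hS (Fintype.equivFinOfCardEq hcard)⟩

variable (σ k) in
/-- The generating set of the dilation group: the scalar substitutions `x ↦ t • x`. -/
def scalarGens : Set (GL σ k) := {γ | ∃ t : k, (γ : Matrix σ σ k) = Matrix.diagonal fun _ => t}

/-- **The graded bridge.**  A `Γ`-equivariant homogeneous layered program of width `w ≥ 1` and length `L`
yields an affine determinantal representation of size `w (L + 3)` that is EXACTLY equivariant under `Γ` AND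
under the dilations `x ↦ t • x` (Valiant's matrix; the dilation lifts are `⊕_levels t^{-level}`). -/
theorem hasEquivariantDetRepr_graded_of_isEquivariant {Γ : Subgroup (GL σ k)} (hP : P.IsEquivariant Γ) :
    HasEquivariantDetRepr (Γ ⊔ Subgroup.closure (scalarGens σ k)) P.eval (w * (L + 3)) := by
  have hgen : Γ ⊔ Subgroup.closure (scalarGens σ k) = Subgroup.closure ((Γ : Set (GL σ k)) ∪ scalarGens σ k) := by
    rw [Subgroup.closure_union, Subgroup.closure_eq]
  rw [hgen]
  refine P.hasEquivariantDetRepr_closure_of_lifts fun γ hγ => ?_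
  rcases hγ with hγ | hγ
  · exact hP γ hγ
  · exact P.nonempty_lift_of_scalar γ hγ

end LayeredABP

/-- **Graded bridge, existential form** (width `0` included): `Γ`-equivariant layered width `w` in length `L`
gives a `Γ ⊔ (dilations)`-equivariant determinantal representation of size `≤ w (L + 3) + 1`. -/
theorem HasLayeredWidthLE.exists_hasEquivariantDetRepr_graded {Γ : Subgroup (GL σ k)} {f : MvPolynomial σ k}
    (h : HasLayeredWidthLE Γ f L w) :
    ∃ s : ℕ, s ≤ w * (L + 3) + 1 ∧ HasEquivariantDetRepr (Γ ⊔ Subgroup.closure (LayeredABP.scalarGens σ k)) f s := by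
  obtain ⟨P, hP, rfl⟩ := h
  rcases Nat.eq_zero_or_pos w with rfl | hw
  · refine ⟨1, by omega, ?_⟩
    rw [P.eval_eq_zero_of_width_zero]
    exact hasEquivariantDetRepr_zero_one
  · haveI : NeZero w := ⟨hw.ne'⟩
    exact ⟨w * (L + 3), by omega, P.hasEquivariantDetRepr_graded_of_isEquivariant hP⟩

end Generate

/-! ## §4 Over `ℂ`: `A^gr ⟹ A^lay`, and Theorem H reduces to layering -/

section Cells

variable {H : ∀ m : ℕ, Subgroup (GL (Fin m × Fin m) ℂ)}

/-- The tree's `scalarSubst m` is the subgroup generated by `scalarGens`. -/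
theorem scalarSubst_eq_closure (m : ℕ) :
    scalarSubst m = Subgroup.closure (LayeredABP.scalarGens (Fin m × Fin m) ℂ) := rfl

/-- KERNEL: an `H_m`-equivariant layered program for `per_m` of width `w`, length `m`, gives a GRADED
`H_m`-equivariant determinantal representation (equivariant under `graded H m = H m ⊔ scalarSubst m`) of size
`≤ w (m + 3) + 1`. -/
theorem exists_hasEquivariantDetRepr_graded_of_layered {m w : ℕ}
    (h : HasLayeredWidthLE (H m) (perPoly (Fin m) ℂ) m w) :
    ∃ s : ℕ, s ≤ w * (m + 3) + 1 ∧ HasEquivariantDetRepr (graded H m) (perPoly (Fin m) ℂ) s :=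
  h.exists_hasEquivariantDetRepr_graded

/-- KERNEL: `PolyLayered H ⟹ PolyEquivariant (graded H)` — polynomial equivariant layered width gives a
polynomial family that is equivariant ALSO under the dilations. -/
theorem polyEquivariant_graded_of_polyLayered (h : PolyLayered H) : PolyEquivariant (graded H) := by
  obtain ⟨c, hc⟩ := h
  obtain ⟨c', hc'⟩ := isPBounded_cost 2 2 c
  refine ⟨c', fun m => ?_⟩
  obtain ⟨w, hw, hW⟩ := hc m
  obtain ⟨s, hs, hA⟩ := exists_hasEquivariantDetRepr_graded_of_layered hW
  refine ⟨s, hs.trans (le_trans ?_ (hc' m)), hA⟩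
  have h1 : w * (m + 3) ≤ (m ^ c + c) * (m + 3) := Nat.mul_le_mul_right _ hw
  nlinarith [h1, Nat.zero_le m, Nat.zero_le (m ^ c + c)]

/-- **CENSUS ARROW `A^gr ⟹ A^lay`** (KERNEL): hardness at the graded notch descends to the layered notch. -/
theorem eqHardLayered_of_eqHardGraded (h : EqHard (graded H)) : EqHardLayered H :=
  fun hl => h (polyEquivariant_graded_of_polyLayered hl)

/-- At the window: `EqHardBiPermGraded ⟹ EqHardLayeredBiPerm`. -/
theorem eqHardLayeredBiPerm_of_eqHardBiPermGraded (h : EqHardBiPermGraded) : EqHardLayeredBiPerm :=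
  eqHardLayered_of_eqHardGraded h

/-- **Layering cost** at the notch `H` (= arrows 1+2 of Theorem H, NODE-g13 §2 (0)–(4)): every
`H_m`-equivariant affine determinantal representation of `per_m` of size `s` yields an `H_m`-equivariant
HOMOGENEOUS LAYERED program of width `≤ a (m + s + 1)^b`, uniformly.  (Paper-proved for finite `H ≤ 𝔾_per`;
Lean-open: arrow 1 = invariant block gauge by Wedderburn–Maschke, arrow 2 = Schur complement + Le Verrier.) -/
def LayeringCost (H : ∀ m : ℕ, Subgroup (GL (Fin m × Fin m) ℂ)) : Prop :=
  ∃ a b : ℕ, ∀ m s : ℕ, HasEquivariantDetRepr (H m) (perPoly (Fin m) ℂ) s →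
    ∃ w : ℕ, w ≤ a * (m + s + 1) ^ b ∧ HasLayeredWidthLE (H m) (perPoly (Fin m) ℂ) m w

/-- «Layering is free at `H`»: a polynomial equivariant family can be made layered at polynomial cost. -/
def LayeringFree (H : ∀ m : ℕ, Subgroup (GL (Fin m × Fin m) ℂ)) : Prop := PolyEquivariant H → PolyLayered H

/-- Arithmetic of the bridge: `w (m+3) + 1 ≤ (3a+1) (m+s+1)^(b+1)` when `w ≤ a (m+s+1)^b`. -/
theorem bridge_cost_le {a b m s w : ℕ} (hw : w ≤ a * (m + s + 1) ^ b) :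
    w * (m + 3) + 1 ≤ (3 * a + 1) * (m + s + 1) ^ (b + 1) := by
  have h1 : w * (m + 3) ≤ a * (m + s + 1) ^ b * (3 * (m + s + 1)) :=
    Nat.mul_le_mul hw (by omega)
  have h2 : 1 ≤ (m + s + 1) ^ (b + 1) := Nat.one_le_pow _ _ (by omega)
  calc w * (m + 3) + 1 ≤ a * (m + s + 1) ^ b * (3 * (m + s + 1)) + (m + s + 1) ^ (b + 1) := Nat.add_le_add h1 h2
    _ = (3 * a + 1) * (m + s + 1) ^ (b + 1) := by ring

/-- **THEOREM H REDUCES TO LAYERING** (KERNEL): a uniform polynomial layering cost gives the uniform polynomial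
grading cost `GradingCost H` of `EquivariantDialGrading` — the graded bridge is the last arrow. -/
theorem gradingCost_of_layeringCost (h : LayeringCost H) : GradingCost H := by
  obtain ⟨a, b, hab⟩ := h
  refine ⟨3 * a + 1, b + 1, fun m s hA => ?_⟩
  obtain ⟨w, hw, hW⟩ := hab m s hA
  obtain ⟨s', hs', hA'⟩ := exists_hasEquivariantDetRepr_graded_of_layered hW
  exact ⟨s', hs'.trans (bridge_cost_le hw), hA'⟩

/-- A uniform layering cost makes layering free (polynomial ∘ polynomial). -/
theorem layeringFree_of_cost (h : LayeringCost H) : LayeringFree H := by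
  rintro ⟨c, hc⟩
  obtain ⟨a, b, hab⟩ := h
  obtain ⟨c', hc'⟩ := isPBounded_cost a b c
  refine ⟨c', fun m => ?_⟩
  obtain ⟨s, hs, hA⟩ := hc m
  obtain ⟨w, hw, hW⟩ := hab m s hA
  refine ⟨w, hw.trans ?_, hW⟩
  have hmono : a * (m + s + 1) ^ b ≤ a * (m + (m ^ c + c) + 1) ^ b :=
    Nat.mul_le_mul_left a (Nat.pow_le_pow_left (by omega) b)
  exact hmono.trans (hc' m)

/-- Layering-freeness gives grading-freeness (the graded bridge). -/
theorem gradingFree_of_layeringFree (h : LayeringFree H) : GradingFree H :=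
  fun hP => polyEquivariant_graded_of_polyLayered (h hP)

/-- Under layering-freeness the hardness pieces at `H` and at the LAYERED notch coincide (`A ⟺ A^lay`). -/
theorem eqHard_iff_layered (h : LayeringFree H) : EqHard H ↔ EqHardLayered H :=
  ⟨eqHardLayered_of_eqHard, fun hA hP => hA (h hP)⟩

/-- … and so do the GRADED and the layered notch (`A^gr ⟺ A^lay`). -/
theorem eqHardGraded_iff_layered (h : LayeringFree H) : EqHard (graded H) ↔ EqHardLayered H :=
  ⟨eqHardLayered_of_eqHardGraded, fun hA => eqHard_graded_of_eqHard ((eqHard_iff_layered h).2 hA)⟩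

/-- At the window, given a layering cost: cell `A = EqHardBiPerm` IS the layered cell `A^lay`. -/
theorem eqHardBiPerm_iff_layered_of_cost (h : LayeringCost biPermSubst) : EqHardBiPerm ↔ EqHardLayeredBiPerm :=
  eqHard_iff_layered (layeringFree_of_cost h)

end Cells

end

end Summit.ValiantsHypothesis.ValiantsHypothesis.Theorems.EquivariantDialLayers
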